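import Summits.HubbardSuperconductivity.HubbardSuperconductivity.Theorems.AnisotropyChordStiffnessNearFarPairs

/-!
# Route `AnisotropyChord` / H0 rotor rung: stub D4 `KernelLipschitzAtScale` FROM the far-field kernel decay K2,
# the kernel symmetry K3 and the torus geometry G2–G5 (theory seat memo ROTOR-THEORY-8 §122(d)/§123; Sketch8 Part S, second half)

The constant bookkeeping `nearFar_near` / `nearFar_far1` / `nearFar_far2` / `nearFar_constants`, the pair
coefficient / kernel `pairCoef` / `pairKernel`, and **`kernelLipschitzAtScale_of_farField :
PhaseLipschitz → BallCount → FarExpSum → BondCurrentBound → FarFieldKernelDecay Δ M → FilteredKernelSymmetric Δ M →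
KernelLipschitzAtScale Δ M`** with `A = 36 + 32c(1+4v+4v²) + 32cC_LR(1+2/μ+4/μ²)`, `v_{D4} = 2v`, `μ_{D4} = μ/2`.
Typing authority: theory seat `hubbard-h0-rotor-theory-1`, cycle 8.
-/

set_option linter.dupNamespace false

noncomputable section

open Matrix Complex Finset Filter Topology MeasureTheory
open scoped ComplexConjugate
open Literature.MathematicalPhysics.QuantumLattice hiding torusPhase torusNorm
open Literature.Probability.LatticeModels
open Summit.HubbardSuperconductivity.HubbardSuperconductivity.Theorems.AnisotropyChord.InsertionEntropy

namespace Summit.HubbardSuperconductivity.HubbardSuperconductivity.Theorems.AnisotropyChord.Stiffness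

/-- Near-field constant: `4(2R+1)²·(2κR/(2Ω)) ≤ 36 κR³/Ω` for `R ≥ 1`. -/
theorem nearFar_near {R Ω κ : ℝ} (hR : 1 ≤ R) (hΩ : 0 < Ω) (hκ : 0 ≤ κ) :
    4 * ((2 * R + 1) ^ 2 * (2 * κ * R / (2 * Ω))) ≤ 36 * (κ * R ^ 3 / Ω) := by
  have hR0 : 0 ≤ R := by linarith
  have hΩne : Ω ≠ 0 := hΩ.ne'
  have n1 : 4 * ((2 * R + 1) ^ 2 * (2 * κ * R / (2 * Ω))) = (2 * R + 1) ^ 2 * R * (4 * κ / Ω) := by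
    field_simp
  have hsq : (2 * R + 1) ^ 2 * R ≤ 9 * R ^ 2 * R := by nlinarith
  have hpos : 0 ≤ 4 * κ / Ω := by positivity
  have := mul_le_mul_of_nonneg_right hsq hpos
  have e : 9 * R ^ 2 * R * (4 * κ / Ω) = 36 * (κ * R ^ 3 / Ω) := by
    field_simp; ring
  linarith

/-- First far-field constant. -/
theorem nearFar_far1 {R Ω c v e₁ : ℝ} (hR : 1 ≤ R) (hΩ : 0 < Ω) (hc : 0 ≤ c) (hv : 0 < v) (he₁ : 0 ≤ e₁) :
    4 * (c / Ω * (8 * e₁ * ((R + 1) * (1 + 1 / (Ω / (2 * v))) + 1 / (Ω / (2 * v)) ^ 2)))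
      ≤ 32 * c * (1 + 4 * v + 4 * v ^ 2) * (((R + 1) / Ω + R / Ω ^ 2 + 1 / Ω ^ 3) * e₁) := by
  have hR0 : 0 ≤ R := by linarith
  have hΩne : Ω ≠ 0 := hΩ.ne'
  have hvne : v ≠ 0 := hv.ne'
  have n2 : 4 * (c / Ω * (8 * e₁ * ((R + 1) * (1 + 1 / (Ω / (2 * v))) + 1 / (Ω / (2 * v)) ^ 2)))
      = 32 * c * e₁ * ((R + 1) / Ω + 2 * v * (R + 1) / Ω ^ 2 + 4 * v ^ 2 / Ω ^ 3) := by
    field_simp; ring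
  rw [n2]
  have q1 : 0 ≤ (R + 1) / Ω := by positivity
  have q2 : 0 ≤ 1 / Ω ^ 2 := by positivity
  have q3 : 0 ≤ 1 / Ω ^ 3 := by positivity
  have hK1 : (R + 1) / Ω ≤ (1 + 4 * v + 4 * v ^ 2) * ((R + 1) / Ω) := by
    have := mul_nonneg (by positivity : (0 : ℝ) ≤ 4 * v + 4 * v ^ 2) q1
    linarith
  have hK2 : 2 * v * (R + 1) / Ω ^ 2 ≤ (1 + 4 * v + 4 * v ^ 2) * (R / Ω ^ 2) := by
    have ea : 2 * v * (R + 1) / Ω ^ 2 = (2 * v * (R + 1)) * (1 / Ω ^ 2) := by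
      field_simp
    have eb : (1 + 4 * v + 4 * v ^ 2) * (R / Ω ^ 2) = ((1 + 4 * v + 4 * v ^ 2) * R) * (1 / Ω ^ 2) := by
      field_simp
    rw [ea, eb]
    apply mul_le_mul_of_nonneg_right _ q2
    have h1 := mul_nonneg hv.le (sub_nonneg.2 hR)
    have h2 : 0 ≤ (1 + 4 * v ^ 2) * R := by positivity
    nlinarith
  have hK3 : 4 * v ^ 2 / Ω ^ 3 ≤ (1 + 4 * v + 4 * v ^ 2) * (1 / Ω ^ 3) := by
    have ea : 4 * v ^ 2 / Ω ^ 3 = (4 * v ^ 2) * (1 / Ω ^ 3) := by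
      field_simp
    rw [ea]
    apply mul_le_mul_of_nonneg_right _ q3
    nlinarith
  have hsum : (R + 1) / Ω + 2 * v * (R + 1) / Ω ^ 2 + 4 * v ^ 2 / Ω ^ 3
      ≤ (1 + 4 * v + 4 * v ^ 2) * ((R + 1) / Ω + R / Ω ^ 2 + 1 / Ω ^ 3) := by
    linarith
  have h32 : 0 ≤ 32 * c * e₁ := by positivity
  have := mul_le_mul_of_nonneg_left hsum h32
  have e : 32 * c * e₁ * ((1 + 4 * v + 4 * v ^ 2) * ((R + 1) / Ω + R / Ω ^ 2 + 1 / Ω ^ 3))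
      = 32 * c * (1 + 4 * v + 4 * v ^ 2) * (((R + 1) / Ω + R / Ω ^ 2 + 1 / Ω ^ 3) * e₁) := by ring
  linarith

/-- Second far-field constant. -/
theorem nearFar_far2 {R Ω c μ CLR e₂ : ℝ} (hR : 1 ≤ R) (hΩ : 0 < Ω) (hc : 0 ≤ c) (hμ : 0 < μ)
    (hCLR : 0 ≤ CLR) (he₂ : 0 ≤ e₂) :
    4 * (c / Ω * (CLR * (8 * e₂ * ((R + 1) * (1 + 1 / (μ / 2)) + 1 / (μ / 2) ^ 2))))
      ≤ 32 * c * CLR * (1 + 2 / μ + 4 / μ ^ 2) * ((R + 1) / Ω * e₂) := by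
  have hR0 : 0 ≤ R := by linarith
  have hΩne : Ω ≠ 0 := hΩ.ne'
  have hμne : μ ≠ 0 := hμ.ne'
  have n3 : 4 * (c / Ω * (CLR * (8 * e₂ * ((R + 1) * (1 + 1 / (μ / 2)) + 1 / (μ / 2) ^ 2))))
      = 32 * c * CLR * e₂ / Ω * ((R + 1) * (1 + 2 / μ) + 4 / μ ^ 2) := by
    field_simp; ring
  rw [n3]
  have hin : (R + 1) * (1 + 2 / μ) + 4 / μ ^ 2 ≤ (R + 1) * (1 + 2 / μ + 4 / μ ^ 2) := by
    have h4 : 0 ≤ 4 / μ ^ 2 := by positivity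
    have := mul_nonneg hR0 h4
    nlinarith
  have hpre : 0 ≤ 32 * c * CLR * e₂ / Ω := by positivity
  have := mul_le_mul_of_nonneg_left hin hpre
  have e : 32 * c * CLR * e₂ / Ω * ((R + 1) * (1 + 2 / μ + 4 / μ ^ 2))
      = 32 * c * CLR * (1 + 2 / μ + 4 / μ ^ 2) * ((R + 1) / Ω * e₂) := by
    field_simp
  linarith

/-- The constants: `4·(per-site bound) ≤ A·(D4 error shape)` for `R ≥ 1`. -/
theorem nearFar_constants {R Ω κ c v μ CLR e₁ e₂ : ℝ} (hR : 1 ≤ R) (hΩ : 0 < Ω) (hκ : 0 ≤ κ)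
    (hc : 0 ≤ c) (hv : 0 < v) (hμ : 0 < μ) (hCLR : 0 ≤ CLR) (he₁ : 0 ≤ e₁) (he₂ : 0 ≤ e₂) :
    4 * ((2 * R + 1) ^ 2 * (2 * κ * R / (2 * Ω))
        + c / Ω * (8 * e₁ * ((R + 1) * (1 + 1 / (Ω / (2 * v))) + 1 / (Ω / (2 * v)) ^ 2)
          + CLR * (8 * e₂ * ((R + 1) * (1 + 1 / (μ / 2)) + 1 / (μ / 2) ^ 2))))
      ≤ (36 + 32 * c * (1 + 4 * v + 4 * v ^ 2) + 32 * c * CLR * (1 + 2 / μ + 4 / μ ^ 2))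
        * (κ * R ^ 3 / Ω + ((R + 1) / Ω + R / Ω ^ 2 + 1 / Ω ^ 3) * e₁ + (R + 1) / Ω * e₂) := by
  have hR0 : 0 ≤ R := by linarith
  have t1 := nearFar_near hR hΩ hκ
  have t2 := nearFar_far1 (c := c) hR hΩ hc hv he₁
  have t3 := nearFar_far2 (c := c) hR hΩ hc hμ hCLR he₂
  have p1 : 0 ≤ κ * R ^ 3 / Ω := by positivity
  have p2 : 0 ≤ ((R + 1) / Ω + R / Ω ^ 2 + 1 / Ω ^ 3) * e₁ := by positivity
  have p3 : 0 ≤ (R + 1) / Ω * e₂ := by positivity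
  have a1 : (0 : ℝ) ≤ 36 := by norm_num
  have a2 : 0 ≤ 32 * c * (1 + 4 * v + 4 * v ^ 2) := by positivity
  have a3 : 0 ≤ 32 * c * CLR * (1 + 2 / μ + 4 / μ ^ 2) := by positivity
  have x12 := mul_nonneg a1 p2
  have x13 := mul_nonneg a1 p3
  have x21 := mul_nonneg a2 p1
  have x23 := mul_nonneg a2 p3
  have x31 := mul_nonneg a3 p1
  have x32 := mul_nonneg a3 p2
  have expand : 4 * ((2 * R + 1) ^ 2 * (2 * κ * R / (2 * Ω))
        + c / Ω * (8 * e₁ * ((R + 1) * (1 + 1 / (Ω / (2 * v))) + 1 / (Ω / (2 * v)) ^ 2)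
          + CLR * (8 * e₂ * ((R + 1) * (1 + 1 / (μ / 2)) + 1 / (μ / 2) ^ 2))))
      = 4 * ((2 * R + 1) ^ 2 * (2 * κ * R / (2 * Ω)))
        + 4 * (c / Ω * (8 * e₁ * ((R + 1) * (1 + 1 / (Ω / (2 * v))) + 1 / (Ω / (2 * v)) ^ 2)))
        + 4 * (c / Ω * (CLR * (8 * e₂ * ((R + 1) * (1 + 1 / (μ / 2)) + 1 / (μ / 2) ^ 2)))) := by ring
  have rhs : (36 + 32 * c * (1 + 4 * v + 4 * v ^ 2) + 32 * c * CLR * (1 + 2 / μ + 4 / μ ^ 2))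
        * (κ * R ^ 3 / Ω + ((R + 1) / Ω + R / Ω ^ 2 + 1 / Ω ^ 3) * e₁ + (R + 1) / Ω * e₂)
      = 36 * (κ * R ^ 3 / Ω)
        + 32 * c * (1 + 4 * v + 4 * v ^ 2) * (((R + 1) / Ω + R / Ω ^ 2 + 1 / Ω ^ 3) * e₁)
        + 32 * c * CLR * (1 + 2 / μ + 4 / μ ^ 2) * ((R + 1) / Ω * e₂)
        + (36 * (((R + 1) / Ω + R / Ω ^ 2 + 1 / Ω ^ 3) * e₁) + 36 * ((R + 1) / Ω * e₂)
          + 32 * c * (1 + 4 * v + 4 * v ^ 2) * (κ * R ^ 3 / Ω)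
          + 32 * c * (1 + 4 * v + 4 * v ^ 2) * ((R + 1) / Ω * e₂)
          + 32 * c * CLR * (1 + 2 / μ + 4 / μ ^ 2) * (κ * R ^ 3 / Ω)
          + 32 * c * CLR * (1 + 2 / μ + 4 / μ ^ 2) * (((R + 1) / Ω + R / Ω ^ 2 + 1 / Ω ^ 3) * e₁)) := by
    ring
  rw [expand, rhs]
  linarith [t1, t2, t3, x12, x13, x21, x23, x31, x32]

/-- Pair coefficient `c_p(q) = conj(εⱼ φ_q(x)) · ε_{j'} φ_q(y)` and pair kernel `F_p`. -/
def pairCoef (L : ℕ) [NeZero L] (ε : Fin 2 → ℂ) (q : TorusSite 2 L)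
    (p : (TorusSite 2 L × Fin 2) × (TorusSite 2 L × Fin 2)) : ℂ :=
  starRingEnd ℂ (ε p.1.2 * torusPhase L q p.1.1) * (ε p.2.2 * torusPhase L q p.2.1)

/-- The pair kernel `F_p = F_{(x,j),(y,j')}`. -/
def pairKernel (L : ℕ) [NeZero L] (Δ M : ℝ) (a : (TorusSite 2 L → Fin 2) → ℝ) (Ω : ℝ)
    (p : (TorusSite 2 L × Fin 2) × (TorusSite 2 L × Fin 2)) : ℂ :=
  filteredKernel L Δ M a Ω p.1.1 p.1.2 p.2.1 p.2.2

/-- **D4 PROVED FROM K2 ∧ K3 ∧ G2–G5: `KernelLipschitzAtScale`** with `A = 36 + 32c(1+4v+4v²) + 32cC_LR(1+2/μ+4/μ²)`,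
`v_{D4} = 2v`, `μ_{D4} = μ/2`. -/
theorem kernelLipschitzAtScale_of_farField (Δ : ℝ) (M : ℕ → ℝ) (hG2 : PhaseLipschitz) (hG3 : BallCount)
    (hG4 : FarExpSum) (hG5 : BondCurrentBound) (hK2 : FarFieldKernelDecay Δ M)
    (hK3 : FilteredKernelSymmetric Δ M) : KernelLipschitzAtScale Δ M := by
  obtain ⟨c, hc, v, hv, μ, hμ, CLR, hCLR, hK2ev⟩ := hK2
  refine ⟨36 + 32 * c * (1 + 4 * v + 4 * v ^ 2) + 32 * c * CLR * (1 + 2 / μ + 4 / μ ^ 2), by positivity,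
    2 * v, by positivity, μ / 2, by positivity, ?_⟩
  filter_upwards [hK2ev] with L hK2L
  intro _inst a ha k ε Ω hΩ R hR1 hR4
  have hR0 : 0 ≤ R := by linarith
  have hunit := norm_toC_eq_one L ha
  have hfar : ∀ (x y : TorusSite 2 L) (j j' : Fin 2),
      ‖filteredKernel L Δ (M L - 1) a Ω x j y j' + filteredKernel L Δ (M L - 1) a Ω y j' x j‖
        ≤ c / Ω * (Real.exp (-(Ω * tdist L x y / (2 * v))) + CLR * Real.exp (-(μ * tdist L x y / 2))) :=
    fun x y j j' => hK2L a ha Ω hΩ x y j j'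
  have hsymm : ∀ (x : TorusSite 2 L) (j : Fin 2) (y : TorusSite 2 L) (j' : Fin 2),
      filteredKernel L Δ (M L - 1) a Ω x j y j' = filteredKernel L Δ (M L - 1) a Ω y j' x j :=
    fun x j y j' => hK3 L a ha Ω x j y j'
  -- Step 1: the difference as a pair sum
  have hk : ((filteredForm L Δ (M L - 1) a Ω k ε : ℝ) : ℂ)
      = ∑ p, pairCoef L ε k p * pairKernel L Δ (M L - 1) a Ω p := by
    unfold filteredForm pairCoef pairKernel; exact filteredForm_eq_kernel_sum L Δ (M L - 1) a Ω k ε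
  have h0 : ((filteredForm L Δ (M L - 1) a Ω 0 ε : ℝ) : ℂ)
      = ∑ p, pairCoef L ε 0 p * pairKernel L Δ (M L - 1) a Ω p := by
    unfold filteredForm pairCoef pairKernel; exact filteredForm_eq_kernel_sum L Δ (M L - 1) a Ω 0 ε
  have hdiff : filteredForm L Δ (M L - 1) a Ω k ε - filteredForm L Δ (M L - 1) a Ω 0 ε
      = (∑ p, (pairCoef L ε k p - pairCoef L ε 0 p) * pairKernel L Δ (M L - 1) a Ω p).re := by
    have : ((filteredForm L Δ (M L - 1) a Ω k ε - filteredForm L Δ (M L - 1) a Ω 0 ε : ℝ) : ℂ)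
        = ∑ p, (pairCoef L ε k p - pairCoef L ε 0 p) * pairKernel L Δ (M L - 1) a Ω p := by
      rw [Complex.ofReal_sub, hk, h0, ← Finset.sum_sub_distrib]
      refine Finset.sum_congr rfl fun p _ => by ring
    rw [← this, Complex.ofReal_re]
  -- Step 2: termwise bound and summation
  have hterm : ∀ p : (TorusSite 2 L × Fin 2) × (TorusSite 2 L × Fin 2),
      ‖(pairCoef L ε k p - pairCoef L ε 0 p) * pairKernel L Δ (M L - 1) a Ω p‖
        ≤ ‖ε p.1.2‖ * ‖ε p.2.2‖ * pairWeight L Ω k c v μ CLR R p.1.1 p.2.1 := by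
    intro p
    unfold pairCoef pairKernel
    exact pairTerm_bound L Δ (M L - 1) a hunit Ω hΩ k ε hG2 hG5 hfar hsymm R hR0 p
  have hw : ∀ x y, 0 ≤ pairWeight L Ω k c v μ CLR R x y :=
    fun x y => pairWeight_nonneg L hΩ k hc.le hCLR.le hR0 x y
  have hB := fun x => sum_pairWeight_le hG3 hG4 L hΩ k hc.le hv hμ hCLR.le hR0 x
  have hsumB : ∑ x : TorusSite 2 L, ∑ y, pairWeight L Ω k c v μ CLR R x y
      ≤ (L : ℝ) ^ 2 * perSiteBound L Ω k c v μ CLR R := by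
    calc ∑ x : TorusSite 2 L, ∑ y, pairWeight L Ω k c v μ CLR R x y
        ≤ ∑ x : TorusSite 2 L, perSiteBound L Ω k c v μ CLR R := Finset.sum_le_sum fun x _ => hB x
      _ = (L : ℝ) ^ 2 * perSiteBound L Ω k c v μ CLR R := by
          have hcard : Fintype.card (TorusSite 2 L) = L ^ 2 := by simp [Fintype.card_pi, ZMod.card]
          rw [Finset.sum_const, Finset.card_univ, hcard, nsmul_eq_mul]; push_cast; ring
  have hE : 0 ≤ ∑ i, ‖ε i‖ ^ 2 := by positivity
  have hchain : filteredForm L Δ (M L - 1) a Ω k ε - filteredForm L Δ (M L - 1) a Ω 0 ε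
      ≤ (∑ i, ‖ε i‖ ^ 2) * (4 * ((L : ℝ) ^ 2 * perSiteBound L Ω k c v μ CLR R)) := by
    rw [hdiff]
    calc (∑ p, (pairCoef L ε k p - pairCoef L ε 0 p) * pairKernel L Δ (M L - 1) a Ω p).re
        ≤ ‖∑ p, (pairCoef L ε k p - pairCoef L ε 0 p) * pairKernel L Δ (M L - 1) a Ω p‖ :=
          Complex.re_le_norm _
      _ ≤ ∑ p, ‖(pairCoef L ε k p - pairCoef L ε 0 p) * pairKernel L Δ (M L - 1) a Ω p‖ :=
          norm_sum_le _ _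
      _ ≤ ∑ p : (TorusSite 2 L × Fin 2) × (TorusSite 2 L × Fin 2),
            ‖ε p.1.2‖ * ‖ε p.2.2‖ * pairWeight L Ω k c v μ CLR R p.1.1 p.2.1 :=
          Finset.sum_le_sum fun p _ => hterm p
      _ ≤ (∑ i, ‖ε i‖ ^ 2) * (4 * ∑ x, ∑ y, pairWeight L Ω k c v μ CLR R x y) :=
          sum_pairs_le L ε _ hw
      _ ≤ (∑ i, ‖ε i‖ ^ 2) * (4 * ((L : ℝ) ^ 2 * perSiteBound L Ω k c v μ CLR R)) := by
          apply mul_le_mul_of_nonneg_left _ hE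
          linarith [hsumB]
  -- Step 3: constants
  have hconst := nearFar_constants (κ := torusNorm L k) (c := c) (CLR := CLR)
    (e₁ := Real.exp (-(Ω * R / (2 * v)))) (e₂ := Real.exp (-(μ / 2 * R)))
    hR1 hΩ (torusNorm_nonneg (L := L) k) hc.le hv hμ hCLR.le (Real.exp_pos _).le (Real.exp_pos _).le
  have hL2E : 0 ≤ (L : ℝ) ^ 2 * ∑ i, ‖ε i‖ ^ 2 := by positivity
  have hmul := mul_le_mul_of_nonneg_left hconst hL2E
  have hre : (∑ i, ‖ε i‖ ^ 2) * (4 * ((L : ℝ) ^ 2 * perSiteBound L Ω k c v μ CLR R))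
      = (L : ℝ) ^ 2 * (∑ i, ‖ε i‖ ^ 2) * (4 * ((2 * R + 1) ^ 2 * (2 * torusNorm L k * R / (2 * Ω))
        + c / Ω * (8 * Real.exp (-(Ω * R / (2 * v))) * ((R + 1) * (1 + 1 / (Ω / (2 * v))) + 1 / (Ω / (2 * v)) ^ 2)
          + CLR * (8 * Real.exp (-(μ / 2 * R)) * ((R + 1) * (1 + 1 / (μ / 2)) + 1 / (μ / 2) ^ 2))))) := by
    unfold perSiteBound; ring
  rw [hre] at hchain
  linarith [hchain, hmul]


end Summit.HubbardSuperconductivity.HubbardSuperconductivity.Theorems.AnisotropyChord.Stiffness
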